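import Summits.ResolutionOfSingularities.ResolutionOfSingularities.Theorems.PurelyInseparableDim4PureLeafGlobalWinTheorem
import HarnessLib
import HarnessLib.Audit.Tags

/-!
# Purely inseparable fourfolds — MODE 1h TERMINATES FROM EVERY PURE LEAF over `𝔽₂` at `q = 2`
# (every tie-break, every `𝔽₂`-rational reply; cell res-dim4-pi, D3b in the `Terminates1h` currency)
# [OURS · counted 0 · a theorem about OUR coordinate-centre frame v4, not about resolution]

Width seat `res-dim4-p-10` (g3).  `…PureLeafGlobalWinTheorem` shows that player A WINS the plain global game from
every pure leaf `x^a` over `𝔽₂` with SOME least-cardinality permissible centre.  This file removes A's choice: at every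
state of the pure-leaf class EVERY MODE-1h centre (`IsMode1hCentre 2`: Hironaka-permissible coordinate centre of
least cardinality, ties free — the mode of record, WORD #10) is one the closure theorems of `…PureLeafClassClosure`
handle — a singleton `{x_j}` with `a_j ≥ 2`, or, when every `aᵢ ≤ 1`, a pair of two variables with `a = 1`
(`isMode1hCentre_prod`, `isMode1hCentre_L`) — so every MODE-1h step from a class state lands in the class with a
smaller measure (`step1h_class`), and therefore

* **`no_step1h_chain_monomial`** — there is NO infinite sequence of MODE-1h steps (`Step1h 2`) starting at a pure leaf
  `⟨x^a, r, exc⟩` over `𝔽₂`: every branch of every MODE-1h blow-up tree of a pure leaf is finite, whatever the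
  tie-break among least-cardinality centres and whatever B's `𝔽₂`-rational replies (`no_step1h_chain_class` for the
  whole class).

Context: `Terminates1h 2 2` itself (all states, all fields of characteristic 2) is FALSE — crit-1's K-A-01 2-cycle
`x₂x₃x₄(x₄² + x₃x₄ + x₁x₃²)` — so this is a statement about where the MODE-1h pathology does NOT live.  Larger
(non-minimal) permissible centres are excluded on purpose: `x₀²x₁` with the pair centre `{x₀,x₁}`, chart `x₁`, returns
to itself.  Riders: `𝔽₂`-rational replies only; NOT ∀K; nothing here proves resolution of singularities in dimension
≥ 4 / characteristic `p`; counted 0; AI work, weaker than expert review. bears_on: LADDER-RESOLUTION:D157-DOOR2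
(res-dim4-pi · WORD #60 D3b · WORD #10 MODE 1h). Supports stmt-ResolutionOfSingularities-16155 (helper).
-/

set_option linter.dupNamespace false

open MvPolynomial Finset

open scoped BigOperators

noncomputable section

namespace Summit.ResolutionOfSingularities.ResolutionOfSingularities.Theorems.PIDim4

namespace PureLeafNF

open Literature.AlgebraicGeometry.Resolution
open Literature.AlgebraicGeometry.Resolution.Hauser2010
open CentreBlowup PthPowerFactor

/-! ## 1. The MODE-1h centres at class states -/

/-- **MODE-1h centres at a product state** `N(a,e)`: a singleton `{x_j}` with `2 ≤ a_j`, or — when every `aᵢ ≤ 1` —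
a pair `{x_j, x_k}` with `a_j = a_k = 1`. [folklore] -/
theorem isMode1hCentre_prod (a e : Fin 4 → ℕ) (S : Finset (Fin 4))
    (hS : IsMode1hCentre 2 S (∏ i, X i ^ a i * (1 + X i) ^ e i : MvPolynomial (Fin 4) (ZMod 2))) :
    (∃ j, S = {j} ∧ 2 ≤ a j) ∨
      (∃ j k, j ≠ k ∧ S = {j, k} ∧ a j = 1 ∧ a k = 1 ∧ ∀ i, a i ≤ 1) := by
  obtain ⟨⟨hne, hord⟩, hmin⟩ := hS
  rw [ordAlong_prod] at hord
  have h2 : 2 ≤ degIn S (Finsupp.equivFunOnFinite.symm a) := by exact_mod_cast hord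
  have happ : ∀ i, (Finsupp.equivFunOnFinite.symm a) i = a i := fun _ => rfl
  by_cases hbig : ∃ j, 2 ≤ a j
  · obtain ⟨j, hj⟩ := hbig
    have hperm : IsPermissibleCentre 2 {j} (∏ i, X i ^ a i * (1 + X i) ^ e i : MvPolynomial (Fin 4) (ZMod 2)) :=
      ⟨Finset.singleton_nonempty j, by rw [ordAlong_prod, degIn_singleton]; exact_mod_cast hj⟩
    have hcard := hmin {j} hperm
    rw [Finset.card_singleton] at hcard
    obtain ⟨j', hj'⟩ := Finset.card_eq_one.mp (le_antisymm hcard (Finset.card_pos.mpr hne))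
    refine Or.inl ⟨j', hj', ?_⟩
    rw [hj', degIn_singleton, happ] at h2
    exact h2
  · push Not at hbig
    obtain ⟨j, hjS, hj⟩ : ∃ j ∈ S, a j = 1 := by
      by_contra hno
      push Not at hno
      have h0 : degIn S (Finsupp.equivFunOnFinite.symm a) = 0 :=
        Finset.sum_eq_zero fun i hi => by rw [happ]; have := hbig i; have := hno i hi; omega
      omega
    obtain ⟨k, hkS, hkj, hk⟩ : ∃ k ∈ S, k ≠ j ∧ a k = 1 := by
      by_contra hno
      push Not at hno
      have hsum := Finset.add_sum_erase S (fun i => (Finsupp.equivFunOnFinite.symm a) i) hjS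
      have hrest : ∑ i ∈ S.erase j, (Finsupp.equivFunOnFinite.symm a) i = 0 :=
        Finset.sum_eq_zero fun i hi => by
          obtain ⟨hij, hiS⟩ := Finset.mem_erase.mp hi
          rw [happ]; have := hbig i; have := hno i hiS hij; omega
      unfold degIn at h2
      rw [happ j] at hsum
      omega
    have hperm : IsPermissibleCentre 2 {j, k} (∏ i, X i ^ a i * (1 + X i) ^ e i : MvPolynomial (Fin 4) (ZMod 2)) := by
      refine ⟨⟨j, Finset.mem_insert_self j {k}⟩, ?_⟩
      rw [ordAlong_prod, degIn_pair hkj.symm, happ, happ, hj, hk]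
    have hcard := hmin {j, k} hperm
    rw [Finset.card_pair hkj.symm] at hcard
    have hsub : ({j, k} : Finset (Fin 4)) ⊆ S := by
      intro x hx
      rcases Finset.mem_insert.mp hx with rfl | hx
      · exact hjS
      · rw [Finset.mem_singleton.mp hx]; exact hkS
    have hSeq : ({j, k} : Finset (Fin 4)) = S :=
      Finset.eq_of_subset_of_card_le hsub (by rw [Finset.card_pair hkj.symm]; exact hcard)
    exact Or.inr ⟨j, k, hkj.symm, hSeq.symm, hj, hk, fun i => by have := hbig i; omega⟩

/-- **MODE-1h centres at an L-state** `N(a,e)·(∏_{T}(1+xᵢ)+1)` (all `aᵢ` even, `T ≠ ∅`): a singleton `{x_j}` with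
`2 ≤ a_j`. [folklore] -/
theorem isMode1hCentre_L (a e : Fin 4 → ℕ) (T : Finset (Fin 4)) (ha : ∀ i, a i % 2 = 0) (hT : T.Nonempty)
    (S : Finset (Fin 4))
    (hS : IsMode1hCentre 2 S ((∏ k, X k ^ a k * (1 + X k) ^ e k) *
      ((∏ k, X k ^ (0 : ℕ) * (1 + X k) ^ (if k ∈ T then 1 else 0) : MvPolynomial (Fin 4) (ZMod 2)) + 1))) :
    ∃ j, S = {j} ∧ 2 ≤ a j := by
  obtain ⟨hperm, hmin⟩ := hS
  have hex : ∃ j, a j ≠ 0 := by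
    by_contra hno
    push Not at hno
    exact not_isPermissibleCentre_L a e hno T hT S hperm
  obtain ⟨j, hj0⟩ := hex
  have hj : 2 ≤ a j := by have := ha j; omega
  have hcard := hmin {j} ⟨Finset.singleton_nonempty j, two_le_ordAlong_singleton_prod_mul a e hj _⟩
  rw [Finset.card_singleton] at hcard
  obtain ⟨j', hj'⟩ := Finset.card_eq_one.mp (le_antisymm hcard (Finset.card_pos.mpr hperm.1))
  refine ⟨j', hj', ?_⟩
  -- `{x_{j'}}` permissible forces `a_{j'} ≠ 0`: the monomial `x^a · x_i` (`i ∈ T`) has `x_{j'}`-degree `a_{j'} + [i = j']`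
  by_contra hlt
  have h0 : a j' = 0 := by have := ha j'; omega
  obtain ⟨i, hi⟩ := hT
  have hc := coeff_add_single_L a e T hi
  have hle := ordAlong_le_of_coeff_ne_zero (S := {j'}) (F := (∏ k, X k ^ a k * (1 + X k) ^ e k) *
      ((∏ k, X k ^ (0 : ℕ) * (1 + X k) ^ (if k ∈ T then 1 else 0) : MvPolynomial (Fin 4) (ZMod 2)) + 1))
    (d := Finsupp.equivFunOnFinite.symm a + Finsupp.single i 1) (by rw [hc]; exact one_ne_zero)
  have h2 := hperm.2
  rw [hj'] at h2
  have h := le_trans h2 hle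
  rw [degIn_singleton, Finsupp.add_apply, Finsupp.single_apply] at h
  have h' : (2 : ℕ) ≤ (Finsupp.equivFunOnFinite.symm a) j' + (if i = j' then 1 else 0) := by exact_mod_cast h
  have happ : (Finsupp.equivFunOnFinite.symm a) j' = a j' := rfl
  rw [happ, h0] at h'
  split_ifs at h' <;> omega

/-! ## 2. Every MODE-1h step from a class state lands in the class with a smaller measure -/

/-- **Class closure under `Step1h`.** If `s` is a class product state with `Σ (aᵢ+eᵢ) ≤ n` or a class L-state with
`Σ (aᵢ+eᵢ) + |T| ≤ n`, then every MODE-1h successor `s'` (any least-cardinality permissible centre, any chart, any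
`𝔽₂`-rational equimultiple point with non-zero cleaned transform) is again such a state for some `m < n`.
[OURS · counted 0] [folklore] -/
theorem step1h_class {n : ℕ} {s s' : State (ZMod 2)}
    (hs : (∃ a e : Fin 4 → ℕ, s.F = ∏ i, X i ^ a i * (1 + X i) ^ e i ∧
        (∀ i, e i % 2 = 1 → a i = 0) ∧
        (∀ i, a i % 2 = 1 → 0 < e i → ∀ i', i' ≠ i → a i' % 2 = 0 ∧ e i' % 2 = 0) ∧
        ∑ i, (a i + e i) ≤ n) ∨
      (∃ (a e : Fin 4 → ℕ) (T : Finset (Fin 4)), s.F = (∏ i, X i ^ a i * (1 + X i) ^ e i) *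
          ((∏ i, X i ^ (0 : ℕ) * (1 + X i) ^ (if i ∈ T then 1 else 0) : MvPolynomial (Fin 4) (ZMod 2)) + 1) ∧
        (∀ i, a i % 2 = 0) ∧ (∀ i, e i % 2 = 0) ∧ (∀ i ∈ T, a i = 0) ∧ 2 ≤ T.card ∧
        ∑ i, (a i + e i) + T.card ≤ n))
    (hst : Step1h 2 s s') :
    ∃ m, m < n ∧
      ((∃ a e : Fin 4 → ℕ, s'.F = ∏ i, X i ^ a i * (1 + X i) ^ e i ∧
          (∀ i, e i % 2 = 1 → a i = 0) ∧
          (∀ i, a i % 2 = 1 → 0 < e i → ∀ i', i' ≠ i → a i' % 2 = 0 ∧ e i' % 2 = 0) ∧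
          ∑ i, (a i + e i) ≤ m) ∨
        (∃ (a e : Fin 4 → ℕ) (T : Finset (Fin 4)), s'.F = (∏ i, X i ^ a i * (1 + X i) ^ e i) *
            ((∏ i, X i ^ (0 : ℕ) * (1 + X i) ^ (if i ∈ T then 1 else 0) : MvPolynomial (Fin 4) (ZMod 2)) + 1) ∧
          (∀ i, a i % 2 = 0) ∧ (∀ i, e i % 2 = 0) ∧ (∀ i ∈ T, a i = 0) ∧ 2 ≤ T.card ∧
          ∑ i, (a i + e i) + T.card ≤ m)) := by
  obtain ⟨S, hS, j, b, hjS, hbj, heq, hne, rfl⟩ := hst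
  rcases hs with ⟨a, e, hF, hI5, hI6, hn⟩ | ⟨a, e, T, hF, ha, he, haT, hT, hn⟩
  · rw [hF] at hS
    rcases isMode1hCentre_prod a e S hS with ⟨j₀, rfl, hj₀⟩ | ⟨j₀, k₀, hjk, rfl, hj₀, hk₀, -⟩
    · rw [Finset.mem_singleton] at hjS
      subst hjS
      rcases step_singleton_classU s a e hF hI5 hI6 hj₀ b hne with
        ⟨a₁, e₁, h1, h5, h6, hm⟩ | ⟨a₁, e₁, T, h1, h2, h3, h4, h5, hm⟩
      · exact ⟨_, by omega, Or.inl ⟨a₁, e₁, h1, h5, h6, le_rfl⟩⟩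
      · exact ⟨_, by omega, Or.inr ⟨a₁, e₁, T, h1, h2, h3, h4, h5, le_rfl⟩⟩
    · rcases Finset.mem_insert.mp hjS with rfl | hjk'
      · rcases step_pair_classU s a e hF hI5 hI6 hjk hj₀ hk₀ b hne with
          ⟨a₁, e₁, h1, h5, h6, hm⟩ | ⟨a₁, e₁, T, h1, h2, h3, h4, h5, hm⟩
        · exact ⟨_, by omega, Or.inl ⟨a₁, e₁, h1, h5, h6, le_rfl⟩⟩
        · exact ⟨_, by omega, Or.inr ⟨a₁, e₁, T, h1, h2, h3, h4, h5, le_rfl⟩⟩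
      · rw [Finset.mem_singleton] at hjk'
        subst hjk'
        rw [Finset.pair_comm] at hne ⊢
        rcases step_pair_classU s a e hF hI5 hI6 hjk.symm hk₀ hj₀ b hne with
          ⟨a₁, e₁, h1, h5, h6, hm⟩ | ⟨a₁, e₁, T, h1, h2, h3, h4, h5, hm⟩
        · exact ⟨_, by omega, Or.inl ⟨a₁, e₁, h1, h5, h6, le_rfl⟩⟩
        · exact ⟨_, by omega, Or.inr ⟨a₁, e₁, T, h1, h2, h3, h4, h5, le_rfl⟩⟩
  · rw [hF] at hS
    obtain ⟨j₀, rfl, hj₀⟩ := isMode1hCentre_L a e T ha (Finset.card_pos.mp (by omega)) S hS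
    rw [Finset.mem_singleton] at hjS
    subst hjS
    rcases step_singleton_classL s a e T hF ha he haT hj₀ b with
      ⟨a₁, e₁, h1, h5, h6, hm⟩ | ⟨a₁, e₁, h1, h2, h3, h4, hm⟩
    · exact ⟨_, by omega, Or.inl ⟨a₁, e₁, h1, h5, h6, le_rfl⟩⟩
    · exact ⟨_, by omega, Or.inr ⟨a₁, e₁, T, h1, h2, h3, h4, hT, le_rfl⟩⟩

/-! ## 3. No infinite MODE-1h play -/

/-- **No infinite MODE-1h play from a class state.** [OURS · counted 0] [folklore] -/
theorem no_step1h_chain_class : ∀ (n : ℕ) (s : State (ZMod 2)),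
    ((∃ a e : Fin 4 → ℕ, s.F = ∏ i, X i ^ a i * (1 + X i) ^ e i ∧
        (∀ i, e i % 2 = 1 → a i = 0) ∧
        (∀ i, a i % 2 = 1 → 0 < e i → ∀ i', i' ≠ i → a i' % 2 = 0 ∧ e i' % 2 = 0) ∧
        ∑ i, (a i + e i) ≤ n) ∨
      (∃ (a e : Fin 4 → ℕ) (T : Finset (Fin 4)), s.F = (∏ i, X i ^ a i * (1 + X i) ^ e i) *
          ((∏ i, X i ^ (0 : ℕ) * (1 + X i) ^ (if i ∈ T then 1 else 0) : MvPolynomial (Fin 4) (ZMod 2)) + 1) ∧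
        (∀ i, a i % 2 = 0) ∧ (∀ i, e i % 2 = 0) ∧ (∀ i ∈ T, a i = 0) ∧ 2 ≤ T.card ∧
        ∑ i, (a i + e i) + T.card ≤ n)) →
    ¬ ∃ c : ℕ → State (ZMod 2), c 0 = s ∧ ∀ k, Step1h 2 (c k) (c (k + 1)) := by
  intro n
  induction n using Nat.strong_induction_on with
  | _ n IH =>
  rintro s hs ⟨c, h0, hc⟩
  have h01 := hc 0
  rw [h0] at h01
  obtain ⟨m, hm, hs'⟩ := step1h_class hs h01
  exact IH m hm (c (0 + 1)) hs' ⟨fun k => c (k + 1), rfl, fun k => hc (k + 1)⟩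

/-- **MODE 1h TERMINATES FROM EVERY PURE LEAF OVER `𝔽₂` (`q = 2`).** For every exponent vector `a` and every
booking there is no infinite sequence of MODE-1h steps starting at `⟨x^a, r, exc⟩` — whatever least-cardinality
permissible centre is blown up at each step and whatever `𝔽₂`-rational equimultiple point B replies with.
[OURS · counted 0] [folklore] -/
theorem no_step1h_chain_monomial (a : Fin 4 → ℕ) (r : Fin 4 →₀ ℕ) (exc : Finset (Fin 4)) :
    ¬ ∃ c : ℕ → State (ZMod 2),
      c 0 = (⟨monomial (Finsupp.equivFunOnFinite.symm a) 1, r, exc⟩ : State (ZMod 2)) ∧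
        ∀ k, Step1h 2 (c k) (c (k + 1)) := by
  refine no_step1h_chain_class (∑ i, (a i + 0)) _ (Or.inl ⟨a, fun _ => 0, ?_, fun i hi => by simp at hi,
    fun i _ hi => by simp at hi, le_rfl⟩)
  show monomial (Finsupp.equivFunOnFinite.symm a) (1 : ZMod 2) = ∏ i, X i ^ a i * (1 + X i) ^ (0 : ℕ)
  rw [prod_eq_monomial_mul]; simp

/-- The same for a finitely supported exponent vector (the shape of `PureLeafGlobalWinQuestion`). [OURS · counted 0]
[folklore] -/
theorem no_step1h_chain_monomial' (a : Fin 4 →₀ ℕ) (r : Fin 4 →₀ ℕ) (exc : Finset (Fin 4)) :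
    ¬ ∃ c : ℕ → State (ZMod 2),
      c 0 = (⟨monomial a 1, r, exc⟩ : State (ZMod 2)) ∧ ∀ k, Step1h 2 (c k) (c (k + 1)) := by
  have h := no_step1h_chain_monomial (⇑a) r exc
  rwa [Finsupp.equivFunOnFinite_symm_coe] at h

end PureLeafNF

end Summit.ResolutionOfSingularities.ResolutionOfSingularities.Theorems.PIDim4

end
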